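import Literature.NumberTheory.Automorphic.SmoothTraceLinearIndependence
import Mathlib.Analysis.InnerProductSpace.Basic
import HarnessLib

/-!
# Adjoints and norm bounds of Hecke-algebra elements on the `K`-fixed vectors of a UNITARIZABLE representation
(Deitmar–Echterhoff, *Principles of Harmonic Analysis* (2014), Prop. 6.2.1 «`π(f)* = π(f*)`», Lemma 6.2.? «`‖π(f)‖ ≤ ‖f‖₁`»;
Diamond–Shurman (2005), Prop. 5.5.2; Jacquet–Langlands (1970), Lemma 16.1.1 — the two unitary inputs of the «positivity trick»)

Topic `NumberTheory/Automorphic`; namespace `Literature.NumberTheory.Automorphic`.  THEOREMS ONLY (no definition, no instance, no notation,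
no named fact, no `sorry`); imports ★ `SmoothTraceLinearIndependence` (the `ℋ(G,K)ᵐᵒᵖ`-module `V^K` through ★ `heckeAlgebra.fixedPointsAlgHom`,
`op T_g ↦ [KgK]`) + Mathlib.  Cell `hodgecm-mathlib` (D-0151), floor 0, programme P3 rung 4, file (U2) of the in-house discharge of the letter
★ `unitaryCharactersLinearIndependent` (F0P3-plan (g4) RULING (V17)); generic for ANY Hecke pair `(G, K)` (Mathlib `IsHeckeTriple ⊤ K K`)
and ANY representation `ρ` on a complex space `V` carrying a `G`-INVARIANT HERMITIAN FORM `B : V →ₗ⋆[ℂ] V →ₗ[ℂ] ℂ` (★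
`Representation.IsUnitarizable`'s witness).  NO Haar measure, NO unimodularity: the adjoint of `[KgK]` is the Hecke operator of `Kg⁻¹K`
RESCALED by the ratio of degrees `#(KgK/K) / #(Kg⁻¹K/K)` (which is `1` exactly when the two degrees agree, e.g. `G` unimodular — ★
`invariantPairing_heckeOperator_apply_eq_heckeOperator_inv` is that case for BILINEAR pairings).

* §1 (one double coset, sesquilinear twin of ★ `HeckeOperatorAdjointBilinear`): `sesq_heckeOperator_apply_left ∕ _right` (`B([KgK]x, y) =
  #(KgK/K)·B(ρ g x, y)`, `B(x, [KgK]y) = #(KgK/K)·B(x, ρ g y)` for `x, y ∈ V^K`), **`sesq_heckeOperator_apply_eq_mul_heckeOperator_inv`**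
  (`B([KgK]x, y) = (#(KgK/K)/#(Kg⁻¹K/K)) · B(x, [Kg⁻¹K]y)`), read on `ℋ(G,K)ᵐᵒᵖ`: `sesq_fixedPointsAlgHom_doubleCosetOperator`.
* §2 **`exists_adjoint_fixedPointsAlgHom`** — every `a ∈ ℋ(G,K)ᵐᵒᵖ` has an element `a†` with `B(a·x, y) = B(x, a†·y)` on `V^K` for EVERY
  representation with an invariant form (one `a†` for all `ρ`: `(op T_g)† = (d_g/d_{g⁻¹}) • op T_{g⁻¹}`, extended conjugate-linearly along ★
  `mem_span_range_doubleCosetOperator`); `sesq_mul_adjoint_apply` — for `b := a† * a`: `B(b·x, y) = B(a·x, a·y) = B(x, b·y)`.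
* §3 **`exists_bound_fixedPointsAlgHom`** — every `a` has a constant `M ≥ 0` with `re B(a·x, a·x) ≤ M² · re B(x, x)` on `V^K` for EVERY
  representation with an invariant POSITIVE DEFINITE Hermitian form (`M(op T_g) = #(KgK/K)`: each `ρ(y)` is a `B`-isometry; triangle inequality
  in the norm of Mathlib ★ `InnerProductSpace.ofCore`).
HC_CM is proved only modulo the printed citations until rung 0 closes; this file is count-neutral (generic Hecke-algebra plumbing).

## References
* [DeitmarEchterhoff2014] A. Deitmar, S. Echterhoff, *Principles of Harmonic Analysis*, 2nd ed., Springer (2014), Prop. 6.2.1, Prop. 2.6.2.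
* [DiamondShurman2005] F. Diamond, J. Shurman, *A First Course in Modular Forms*, GTM 228 (2005), Prop. 5.5.2.
* [JacquetLanglands1970] H. Jacquet, R. P. Langlands, *Automorphic Forms on GL(2)*, LNM 114 (1970), Lemma 16.1.1.
* [BushnellHenniart2006] C. J. Bushnell, G. Henniart, *The Local Langlands Conjecture for GL(2)*, Grundlehren 335 (2006), §4.1–4.2.
-/

set_option autoImplicit false

noncomputable section

open MulAction
open scoped Pointwise ComplexConjugate

namespace Literature.NumberTheory.Automorphic

universe u

/-! ## §1 One double coset: `B([KgK] x, y) = (d_g / d_{g⁻¹}) · B(x, [Kg⁻¹K] y)` on `K`-fixed vectors -/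

section OneCoset

variable {G : Type*} [Group G] {V : Type*} [AddCommGroup V] [Module ℂ V] (ρ : Representation ℂ G V)
  (B : V →ₗ⋆[ℂ] V →ₗ[ℂ] ℂ)

/-- A representative of a point of the `K`-orbit of `gK` in `G ⧸ K` has the form `k g k'` with `k, k' ∈ K` (Shimura (1971), Prop. 3.1; the
tree's ★ `exists_out_eq_mul_mul`, restated to keep the imports minimal). [folklore] -/
private theorem exists_out_eq_mul_mul'' {K : Subgroup G} {g : G} {y : G ⧸ K} (hy : y ∈ orbit K (g : G ⧸ K)) :
    ∃ a ∈ K, ∃ a' ∈ K, y.out = a * g * a' := by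
  obtain ⟨a, rfl⟩ := mem_orbit_iff.1 hy
  obtain ⟨h, H⟩ := QuotientGroup.mk_out_eq_mul K ((a : G) * g)
  exact ⟨a, a.2, h, h.2, H⟩

/-- Invariance moves a group element across the form as its inverse: `B (ρ g x) y = B x (ρ g⁻¹ y)` (unitary `π(g)* = π(g⁻¹)`).
[cite: DeitmarEchterhoff2014, Prop. 6.2.1] -/
theorem sesq_apply_map_left (hB : ∀ (g : G) (x y : V), B (ρ g x) (ρ g y) = B x y) (g : G) (x y : V) :
    B (ρ g x) y = B x (ρ g⁻¹ y) := by
  have e : ρ g (ρ g⁻¹ y) = y := by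
    rw [← Module.End.mul_apply, ← map_mul, mul_inv_cancel, map_one, Module.End.one_apply]
  conv_lhs => rw [← e]
  rw [hB]

/-- **`B([KgK] x, y) = #(KgK/K) · B(ρ g x, y)`** for `x, y ∈ V^K` and a `G`-invariant sesquilinear form `B` (each representative is
`a g a′`, `a, a′ ∈ K`). [cite: DeitmarEchterhoff2014, Prop. 6.2.1] [cite: DiamondShurman2005, Prop. 5.5.2] -/
theorem sesq_heckeOperator_apply_left (hB : ∀ (g : G) (x y : V), B (ρ g x) (ρ g y) = B x y) (K : Subgroup G) (g : G)
    (hfin : (orbit K (g : G ⧸ K)).Finite) {x y : V} (hx : x ∈ ρ.fixedPoints K) (hy : y ∈ ρ.fixedPoints K) :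
    B (heckeOperator ρ K g x) y = (hfin.toFinset.card : ℂ) * B (ρ g x) y := by
  classical
  rw [heckeOperator, finsum_mem_eq_finite_toFinset_sum _ hfin, LinearMap.sum_apply, map_sum, LinearMap.sum_apply,
    ← nsmul_eq_mul, ← Finset.sum_const]
  refine Finset.sum_congr rfl fun z hz => ?_
  obtain ⟨a, ha, a', ha', H⟩ := exists_out_eq_mul_mul'' ((Set.Finite.mem_toFinset hfin).1 hz)
  rw [Representation.mem_fixedPoints] at hx hy
  rw [H, map_mul, map_mul, Module.End.mul_apply, Module.End.mul_apply, hx a' ha', sesq_apply_map_left ρ B hB a,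
    hy a⁻¹ (K.inv_mem ha)]

/-- **`B(x, [KgK] y) = #(KgK/K) · B(x, ρ g y)`** for `x, y ∈ V^K`. [cite: DeitmarEchterhoff2014, Prop. 6.2.1] -/
theorem sesq_heckeOperator_apply_right (hB : ∀ (g : G) (x y : V), B (ρ g x) (ρ g y) = B x y) (K : Subgroup G) (g : G)
    (hfin : (orbit K (g : G ⧸ K)).Finite) {x y : V} (hx : x ∈ ρ.fixedPoints K) (hy : y ∈ ρ.fixedPoints K) :
    B x (heckeOperator ρ K g y) = (hfin.toFinset.card : ℂ) * B x (ρ g y) := by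
  classical
  rw [heckeOperator, finsum_mem_eq_finite_toFinset_sum _ hfin, LinearMap.sum_apply, map_sum, ← nsmul_eq_mul, ← Finset.sum_const]
  refine Finset.sum_congr rfl fun z hz => ?_
  obtain ⟨a, ha, a', ha', H⟩ := exists_out_eq_mul_mul'' ((Set.Finite.mem_toFinset hfin).1 hz)
  rw [Representation.mem_fixedPoints] at hx hy
  have e : ρ a (ρ a⁻¹ x) = x := by
    rw [← Module.End.mul_apply, ← map_mul, mul_inv_cancel, map_one, Module.End.one_apply]
  rw [H, map_mul, map_mul, Module.End.mul_apply, Module.End.mul_apply, hy a' ha']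
  conv_lhs => rw [← e]
  rw [hB, hx a⁻¹ (K.inv_mem ha)]

/-- **ADJOINT OF A HECKE OPERATOR, NO UNIMODULARITY**: `B([KgK] x, y) = (#(KgK/K) / #(Kg⁻¹K/K)) · B(x, [Kg⁻¹K] y)` for `x, y ∈ V^K`
(both sides are `#(KgK/K) · B(ρ g x, y)`). [cite: DeitmarEchterhoff2014, Prop. 6.2.1] [cite: DiamondShurman2005, Prop. 5.5.2] -/
theorem sesq_heckeOperator_apply_eq_mul_heckeOperator_inv (hB : ∀ (g : G) (x y : V), B (ρ g x) (ρ g y) = B x y) (K : Subgroup G)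
    (g : G) (hfin : (orbit K (g : G ⧸ K)).Finite) (hfin' : (orbit K ((g⁻¹ : G) : G ⧸ K)).Finite) {x y : V}
    (hx : x ∈ ρ.fixedPoints K) (hy : y ∈ ρ.fixedPoints K) :
    B (heckeOperator ρ K g x) y =
      ((hfin.toFinset.card : ℂ) / (hfin'.toFinset.card : ℂ)) * B x (heckeOperator ρ K g⁻¹ y) := by
  have hne : (hfin'.toFinset.card : ℂ) ≠ 0 := by
    have hpos : 0 < hfin'.toFinset.card :=
      Finset.card_pos.mpr ⟨(g⁻¹ : G), (Set.Finite.mem_toFinset hfin').2 (mem_orbit_self _)⟩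
    exact_mod_cast hpos.ne'
  rw [sesq_heckeOperator_apply_left ρ B hB K g hfin hx hy, sesq_heckeOperator_apply_right ρ B hB K g⁻¹ hfin' hx hy,
    ← sesq_apply_map_left ρ B hB g x y]
  field_simp

end OneCoset

/-! ## §2 Adjoints in `ℋ(G, K)ᵐᵒᵖ` on the fixed vectors of every representation with an invariant form -/

section Adjoint

variable {G : Type*} [Group G] (K : Subgroup G) [IsHeckeTriple (⊤ : Submonoid G) K K]

/-- The double-coset operator on `ℋ(G,K)ᵐᵒᵖ`-module `V^K`, as an element of `V`: `op T_g · x = [KgK] x` (★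
`coe_fixedPointsAlgHom_doubleCosetOperator_apply`) — with §1: **`B(op T_g · x, y) = (d_g/d_{g⁻¹}) · B(x, op T_{g⁻¹} · y)`**, where
`d_g = #(KgK/K)` is read through `Set.ncard`. [cite: DeitmarEchterhoff2014, Prop. 6.2.1] -/
theorem sesq_fixedPointsAlgHom_doubleCosetOperator {V : Type*} [AddCommGroup V] [Module ℂ V] (ρ : Representation ℂ G V)
    (B : V →ₗ⋆[ℂ] V →ₗ[ℂ] ℂ) (hB : ∀ (g : G) (x y : V), B (ρ g x) (ρ g y) = B x y) (g : G) (x y : ρ.fixedPoints K) :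
    B (heckeAlgebra.fixedPointsAlgHom K ρ (MulOpposite.op (heckeAlgebra.doubleCosetOperator K g)) x : V) y =
      (((orbit K (g : G ⧸ K)).ncard : ℂ) / ((orbit K ((g⁻¹ : G) : G ⧸ K)).ncard : ℂ)) *
        B x (heckeAlgebra.fixedPointsAlgHom K ρ (MulOpposite.op (heckeAlgebra.doubleCosetOperator K g⁻¹)) y : V) := by
  rw [coe_fixedPointsAlgHom_doubleCosetOperator_apply, coe_fixedPointsAlgHom_doubleCosetOperator_apply,
    sesq_heckeOperator_apply_eq_mul_heckeOperator_inv ρ B hB K g (finite_orbit_quotient K g) (finite_orbit_quotient K g⁻¹) x.2 y.2,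
    Set.ncard_eq_toFinset_card _ (finite_orbit_quotient K g), Set.ncard_eq_toFinset_card _ (finite_orbit_quotient K g⁻¹)]

/-- **EVERY ELEMENT OF `ℋ(G,K)ᵐᵒᵖ` HAS AN ADJOINT ON THE FIXED VECTORS OF ALL REPRESENTATIONS WITH AN INVARIANT FORM** (Deitmar–Echterhoff
Prop. 6.2.1 «`π(f)* = π(f*)`», algebraically): for `a ∈ ℋ(G,K)ᵐᵒᵖ` there is `a†` with `B(a·x, y) = B(x, a†·y)` for every `x, y ∈ V^K`, every
representation `ρ` of `G` on a complex space `V` and every `G`-invariant sesquilinear `B`.  One `a†` serves all `ρ`: on generators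
`(op T_g)† = (d_g/d_{g⁻¹}) • op T_{g⁻¹}` (§1), extended conjugate-linearly (★ `mem_span_range_doubleCosetOperator`).
[cite: DeitmarEchterhoff2014, Prop. 6.2.1] [cite: JacquetLanglands1970, Lemma 16.1.1] -/
theorem exists_adjoint_fixedPointsAlgHom (a : (heckeAlgebra ℂ G K)ᵐᵒᵖ) :
    ∃ a' : (heckeAlgebra ℂ G K)ᵐᵒᵖ, ∀ {V : Type u} [AddCommGroup V] [Module ℂ V] (ρ : Representation ℂ G V)
      (B : V →ₗ⋆[ℂ] V →ₗ[ℂ] ℂ), (∀ (g : G) (x y : V), B (ρ g x) (ρ g y) = B x y) →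
      ∀ x y : ρ.fixedPoints K,
        B (heckeAlgebra.fixedPointsAlgHom K ρ a x : V) y = B x (heckeAlgebra.fixedPointsAlgHom K ρ a' y : V) := by
  -- induction over the span of the double-coset operators, on `T := unop a`
  suffices h : ∀ T : heckeAlgebra ℂ G K, ∃ a' : (heckeAlgebra ℂ G K)ᵐᵒᵖ, ∀ {V : Type u} [AddCommGroup V] [Module ℂ V]
      (ρ : Representation ℂ G V) (B : V →ₗ⋆[ℂ] V →ₗ[ℂ] ℂ), (∀ (g : G) (x y : V), B (ρ g x) (ρ g y) = B x y) →
      ∀ x y : ρ.fixedPoints K,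
        B (heckeAlgebra.fixedPointsAlgHom K ρ (MulOpposite.op T) x : V) y = B x (heckeAlgebra.fixedPointsAlgHom K ρ a' y : V) by
    obtain ⟨a', h'⟩ := h (MulOpposite.unop a)
    exact ⟨a', fun {V} _ _ ρ => by simpa only [MulOpposite.op_unop] using h' ρ⟩
  intro T
  refine Submodule.span_induction (p := fun T _ => ∃ a' : (heckeAlgebra ℂ G K)ᵐᵒᵖ, ∀ {V : Type u} [AddCommGroup V] [Module ℂ V]
      (ρ : Representation ℂ G V) (B : V →ₗ⋆[ℂ] V →ₗ[ℂ] ℂ), (∀ (g : G) (x y : V), B (ρ g x) (ρ g y) = B x y) →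
      ∀ x y : ρ.fixedPoints K,
        B (heckeAlgebra.fixedPointsAlgHom K ρ (MulOpposite.op T) x : V) y = B x (heckeAlgebra.fixedPointsAlgHom K ρ a' y : V))
    ?_ ?_ ?_ ?_ (heckeAlgebra.mem_span_range_doubleCosetOperator K T)
  · rintro _ ⟨g, rfl⟩
    refine ⟨((((orbit K (g : G ⧸ K)).ncard : ℂ) / ((orbit K ((g⁻¹ : G) : G ⧸ K)).ncard : ℂ)) •
      MulOpposite.op (heckeAlgebra.doubleCosetOperator K g⁻¹)), fun ρ B hB x y => ?_⟩
    rw [sesq_fixedPointsAlgHom_doubleCosetOperator K ρ B hB g x y, map_smul, LinearMap.smul_apply, Submodule.coe_smul, map_smul,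
      smul_eq_mul]
  · exact ⟨0, fun ρ B hB x y => by simp⟩
  · rintro S T - - ⟨S', hS'⟩ ⟨T', hT'⟩
    refine ⟨S' + T', fun ρ B hB x y => ?_⟩
    rw [MulOpposite.op_add, map_add, map_add, LinearMap.add_apply, LinearMap.add_apply, Submodule.coe_add, Submodule.coe_add,
      map_add, LinearMap.add_apply, map_add, hS' ρ B hB x y, hT' ρ B hB x y]
  · rintro c T - ⟨T', hT'⟩
    refine ⟨conj c • T', fun ρ B hB x y => ?_⟩
    rw [MulOpposite.op_smul, map_smul, map_smul, LinearMap.smul_apply, LinearMap.smul_apply, Submodule.coe_smul, Submodule.coe_smul,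
      LinearMap.map_smulₛₗ, LinearMap.smul_apply, map_smul, smul_eq_mul, smul_eq_mul, starRingEnd_apply, hT' ρ B hB x y]

omit [IsHeckeTriple (⊤ : Submonoid G) K K] in
/-- **`b := a† * a` is `B`-self-adjoint and squares `a`**: `B(b·x, y) = B(a·x, a·y)` and `B(x, b·y) = B(a·x, a·y)` on `V^K`, for a Hermitian
invariant `B` (`B.IsSymm`). [cite: DeitmarEchterhoff2014, Prop. 6.2.1] [cite: JacquetLanglands1970, Lemma 16.1.1] -/
theorem sesq_mul_adjoint_apply {V : Type u} [AddCommGroup V] [Module ℂ V] (ρ : Representation ℂ G V)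
    (B : V →ₗ⋆[ℂ] V →ₗ[ℂ] ℂ) (hBs : B.IsSymm) {a a' : (heckeAlgebra ℂ G K)ᵐᵒᵖ}
    (hadj : ∀ x y : ρ.fixedPoints K,
      B (heckeAlgebra.fixedPointsAlgHom K ρ a x : V) y = B x (heckeAlgebra.fixedPointsAlgHom K ρ a' y : V))
    (x y : ρ.fixedPoints K) :
    B (heckeAlgebra.fixedPointsAlgHom K ρ (a' * a) x : V) y =
        B (heckeAlgebra.fixedPointsAlgHom K ρ a x : V) (heckeAlgebra.fixedPointsAlgHom K ρ a y : V) ∧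
      B x (heckeAlgebra.fixedPointsAlgHom K ρ (a' * a) y : V) =
        B (heckeAlgebra.fixedPointsAlgHom K ρ a x : V) (heckeAlgebra.fixedPointsAlgHom K ρ a y : V) := by
  have h2 : B x (heckeAlgebra.fixedPointsAlgHom K ρ (a' * a) y : V) =
      B (heckeAlgebra.fixedPointsAlgHom K ρ a x : V) (heckeAlgebra.fixedPointsAlgHom K ρ a y : V) := by
    rw [map_mul, Module.End.mul_apply, ← hadj]
  refine ⟨?_, h2⟩
  -- `B(b x, y) = conj B(y, b x) = conj B(a y, a x) = B(a x, a y)`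
  have h3 : B y (heckeAlgebra.fixedPointsAlgHom K ρ (a' * a) x : V) =
      B (heckeAlgebra.fixedPointsAlgHom K ρ a y : V) (heckeAlgebra.fixedPointsAlgHom K ρ a x : V) := by
    rw [map_mul, Module.End.mul_apply, ← hadj]
  rw [← hBs.eq, h3, hBs.eq]

end Adjoint

/-! ## §3 A uniform norm bound on the fixed vectors of every representation with an invariant positive Hermitian form -/

section Bound

variable {G : Type*} [Group G] (K : Subgroup G) [IsHeckeTriple (⊤ : Submonoid G) K K]

/-- For a `G`-invariant POSITIVE DEFINITE Hermitian form `B`, every `ρ(g)` is an isometry of the norm `‖v‖ = √(re B(v,v))` and a Hecke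
operator `[KgK] = ∑_{yK ⊆ KgK} ρ(y)` has norm at most `#(KgK/K)` (on all of `V`; used on `V^K`): **`re B([KgK]x, [KgK]x) ≤ #(KgK/K)² · re B(x, x)`**
(triangle inequality in Mathlib ★ `InnerProductSpace.ofCore`). [cite: DeitmarEchterhoff2014, Prop. 6.2.1] [cite: JacquetLanglands1970, Lemma 16.1.1] -/
theorem re_sesq_heckeOperator_self_le {V : Type u} [AddCommGroup V] [Module ℂ V] (ρ : Representation ℂ G V)
    (B : V →ₗ⋆[ℂ] V →ₗ[ℂ] ℂ) (hBs : B.IsSymm) (hpos : ∀ v : V, v ≠ 0 → 0 < (B v v).re)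
    (hB : ∀ (g : G) (x y : V), B (ρ g x) (ρ g y) = B x y) (g : G) (x : V) :
    (B (heckeOperator ρ K g x) (heckeOperator ρ K g x)).re ≤ ((orbit K (g : G ⧸ K)).ncard : ℝ) ^ 2 * (B x x).re := by
  classical
  -- the inner product space structure on `V` defined by `B`
  have hnn : ∀ v : V, 0 ≤ (B v v).re := fun v => by
    by_cases hv : v = 0
    · rw [hv]; simp
    · exact (hpos v hv).le
  let cd : InnerProductSpace.Core ℂ V :=
    { inner := fun v w => B v w
      conj_inner_symm := fun v w => hBs.eq w v
      re_inner_nonneg := hnn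
      add_left := fun v w z => by rw [map_add, LinearMap.add_apply]
      smul_left := fun v w r => by rw [LinearMap.map_smulₛₗ, LinearMap.smul_apply, smul_eq_mul]
      definite := fun v hv0 => by
        by_contra hv
        exact absurd (hpos v hv) (by simp [show B v v = 0 from hv0]) }
  letI : NormedAddCommGroup V := @InnerProductSpace.Core.toNormedAddCommGroup ℂ V _ _ _ cd
  letI : InnerProductSpace ℂ V := InnerProductSpace.ofCore cd.toCore
  have hnorm : ∀ v : V, ‖v‖ ^ 2 = (B v v).re := fun v => norm_sq_eq_re_inner (𝕜 := ℂ) v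
  -- each `ρ(y)` is an isometry
  have hiso : ∀ (y : G) (v : V), ‖ρ y v‖ = ‖v‖ := fun y v => by
    have h := hnorm (ρ y v)
    rw [hB, ← hnorm] at h
    exact (pow_left_inj₀ (norm_nonneg _) (norm_nonneg _) two_ne_zero).mp h
  -- triangle inequality over the finite orbit
  have hfin := finite_orbit_quotient K g
  have hle : ‖heckeOperator ρ K g x‖ ≤ ((orbit K (g : G ⧸ K)).ncard : ℝ) * ‖x‖ := by
    rw [heckeOperator, finsum_mem_eq_finite_toFinset_sum _ hfin, LinearMap.sum_apply, Set.ncard_eq_toFinset_card _ hfin]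
    calc ‖∑ z ∈ hfin.toFinset, ρ z.out x‖ ≤ ∑ z ∈ hfin.toFinset, ‖ρ z.out x‖ := norm_sum_le _ _
      _ = ∑ _z ∈ hfin.toFinset, ‖x‖ := Finset.sum_congr rfl fun z _ => hiso _ _
      _ = (hfin.toFinset.card : ℝ) * ‖x‖ := by rw [Finset.sum_const, nsmul_eq_mul]
  rw [← hnorm, ← hnorm, ← mul_pow]
  exact pow_le_pow_left₀ (norm_nonneg _) hle 2

/-- **A UNIFORM BOUND FOR EVERY ELEMENT OF `ℋ(G,K)ᵐᵒᵖ`** («`‖π(f)‖ ≤ ‖f‖₁` for unitary `π`», algebraically): for `a ∈ ℋ(G,K)ᵐᵒᵖ` there is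
`M ≥ 0` — depending on `a` ONLY — with `re B(a·x, a·x) ≤ M² · re B(x, x)` for all `x ∈ V^K`, every representation `ρ` of `G` on a complex
space and every `G`-invariant positive definite Hermitian form `B` (on generators `M(op T_g) = #(KgK/K)`, then `M(S+T) = M(S)+M(T)`,
`M(c•T) = ‖c‖·M(T)` along ★ `mem_span_range_doubleCosetOperator`). [cite: DeitmarEchterhoff2014, Prop. 6.2.1] [cite: JacquetLanglands1970, Lemma 16.1.1] -/
theorem exists_bound_fixedPointsAlgHom (a : (heckeAlgebra ℂ G K)ᵐᵒᵖ) :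
    ∃ M : ℝ, 0 ≤ M ∧ ∀ {V : Type u} [AddCommGroup V] [Module ℂ V] (ρ : Representation ℂ G V)
      (B : V →ₗ⋆[ℂ] V →ₗ[ℂ] ℂ), B.IsSymm → (∀ v : V, v ≠ 0 → 0 < (B v v).re) →
      (∀ (g : G) (x y : V), B (ρ g x) (ρ g y) = B x y) →
      ∀ x : ρ.fixedPoints K,
        (B (heckeAlgebra.fixedPointsAlgHom K ρ a x : V) (heckeAlgebra.fixedPointsAlgHom K ρ a x : V)).re ≤
          M ^ 2 * (B (x : V) x).re := by
  classical
  -- the predicate, on `T := unop a`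
  let P : heckeAlgebra ℂ G K → Prop := fun T => ∃ M : ℝ, 0 ≤ M ∧ ∀ {V : Type u} [AddCommGroup V] [Module ℂ V]
      (ρ : Representation ℂ G V) (B : V →ₗ⋆[ℂ] V →ₗ[ℂ] ℂ), B.IsSymm → (∀ v : V, v ≠ 0 → 0 < (B v v).re) →
      (∀ (g : G) (x y : V), B (ρ g x) (ρ g y) = B x y) →
      ∀ x : ρ.fixedPoints K,
        (B (heckeAlgebra.fixedPointsAlgHom K ρ (MulOpposite.op T) x : V)
          (heckeAlgebra.fixedPointsAlgHom K ρ (MulOpposite.op T) x : V)).re ≤ M ^ 2 * (B (x : V) x).re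
  suffices h : ∀ T, P T by
    obtain ⟨M, hM, h⟩ := h (MulOpposite.unop a)
    exact ⟨M, hM, fun {V} _ _ ρ => by simpa only [MulOpposite.op_unop] using h ρ⟩
  -- MINKOWSKI for `p(v) := √(re B(v,v))` on a space with a positive definite Hermitian form (Mathlib ★ `InnerProductSpace.ofCore`)
  have key : ∀ {V : Type u} [AddCommGroup V] [Module ℂ V] (B : V →ₗ⋆[ℂ] V →ₗ[ℂ] ℂ), B.IsSymm →
      (∀ v : V, v ≠ 0 → 0 < (B v v).re) →
      (∀ v : V, 0 ≤ (B v v).re) ∧ ∀ u w : V, √((B (u + w) (u + w)).re) ≤ √((B u u).re) + √((B w w).re) := by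
    intro V _ _ B hBs hpos
    have hnn : ∀ v : V, 0 ≤ (B v v).re := fun v => by
      by_cases hv : v = 0
      · rw [hv]; simp
      · exact (hpos v hv).le
    let cd : InnerProductSpace.Core ℂ V :=
      { inner := fun v w => B v w
        conj_inner_symm := fun v w => hBs.eq w v
        re_inner_nonneg := hnn
        add_left := fun v w z => by rw [map_add, LinearMap.add_apply]
        smul_left := fun v w r => by rw [LinearMap.map_smulₛₗ, LinearMap.smul_apply, smul_eq_mul]
        definite := fun v hv0 => by
          by_contra hv
          exact absurd (hpos v hv) (by simp [show B v v = 0 from hv0]) }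
    letI : NormedAddCommGroup V := @InnerProductSpace.Core.toNormedAddCommGroup ℂ V _ _ _ cd
    letI : InnerProductSpace ℂ V := InnerProductSpace.ofCore cd.toCore
    have hn : ∀ v : V, ‖v‖ = √((B v v).re) := fun v => by rw [norm_eq_sqrt_re_inner (𝕜 := ℂ)]; rfl
    refine ⟨hnn, fun u w => ?_⟩
    rw [← hn, ← hn, ← hn]
    exact norm_add_le u w
  -- `re B(Tx,Tx) ≤ M² re B(x,x)` ⟺ `p(Tx) ≤ M p(x)`
  have hiff : ∀ {V : Type u} [AddCommGroup V] [Module ℂ V] (B : V →ₗ⋆[ℂ] V →ₗ[ℂ] ℂ), (∀ v : V, 0 ≤ (B v v).re) →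
      ∀ {M : ℝ}, 0 ≤ M → ∀ u v : V, ((B u u).re ≤ M ^ 2 * (B v v).re ↔ √((B u u).re) ≤ M * √((B v v).re)) := by
    intro V _ _ B hnn M hM u v
    rw [Real.sqrt_le_left (mul_nonneg hM (Real.sqrt_nonneg _)), mul_pow, Real.sq_sqrt (hnn v)]
  intro T
  refine Submodule.span_induction (p := fun T _ => P T) ?_ ?_ ?_ ?_ (heckeAlgebra.mem_span_range_doubleCosetOperator K T)
  · rintro _ ⟨g, rfl⟩
    refine ⟨((orbit K (g : G ⧸ K)).ncard : ℝ), Nat.cast_nonneg _, fun {V} _ _ ρ B hBs hpos hB x => ?_⟩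
    rw [coe_fixedPointsAlgHom_doubleCosetOperator_apply]
    exact re_sesq_heckeOperator_self_le K ρ B hBs hpos hB g (x : V)
  · refine ⟨0, le_rfl, fun {V} _ _ ρ B hBs hpos hB x => ?_⟩
    simp
  · rintro S T - - ⟨MS, hMS, hS⟩ ⟨MT, hMT, hT⟩
    refine ⟨MS + MT, add_nonneg hMS hMT, fun {V} _ _ ρ B hBs hpos hB x => ?_⟩
    obtain ⟨hnn, hmink⟩ := key B hBs hpos
    have h1 := (hiff B hnn hMS _ _).mp (hS ρ B hBs hpos hB x)
    have h2 := (hiff B hnn hMT _ _).mp (hT ρ B hBs hpos hB x)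
    refine (hiff B hnn (add_nonneg hMS hMT) _ _).mpr ?_
    rw [MulOpposite.op_add, map_add, LinearMap.add_apply, Submodule.coe_add, add_mul]
    exact (hmink _ _).trans (add_le_add h1 h2)
  · rintro c T - ⟨MT, hMT, hT⟩
    refine ⟨‖c‖ * MT, mul_nonneg (norm_nonneg c) hMT, fun {V} _ _ ρ B hBs hpos hB x => ?_⟩
    have h1 := hT ρ B hBs hpos hB x
    have hsm : ∀ u : V, (B (c • u) (c • u)).re = ‖c‖ ^ 2 * (B u u).re := fun u => by
      rw [LinearMap.map_smulₛₗ₂, map_smul, smul_eq_mul, smul_eq_mul, ← mul_assoc, starRingEnd_apply, Complex.star_def,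
        Complex.conj_mul', ← Complex.ofReal_pow, Complex.re_ofReal_mul]
    rw [MulOpposite.op_smul, map_smul, LinearMap.smul_apply, Submodule.coe_smul, hsm, mul_pow, mul_assoc]
    exact mul_le_mul_of_nonneg_left h1 (sq_nonneg _)

end Bound

end Literature.NumberTheory.Automorphic

end
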